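import Mathlib.RingTheory.Ideal.KrullsHeightTheorem
import Mathlib.RingTheory.Ideal.GoingUp
import Mathlib.RingTheory.Ideal.GoingDown
import Mathlib.RingTheory.IntegralClosure.GoingDown
import HarnessLib

/-!
# Crux `FrobeniusLadder.FRationalResolution` (stmt-ResolutionOfSingularities-15317), line `redirect`,
# stub `stub_diagonalizableQuotientResolution` — HEIGHTS (local dimensions) are preserved by integral
# extensions with going-down (step (f) brick of the Kato-(7.1)-at-fixed-points plan, memo §6–§7)

Kato's condition (2.1)(ii) on the invariant neighbourhood compares `dim (S₀)_𝔮'` with `dim S_𝔔'`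
(`S₀ ⊆ S` integral; going-down since `S₀` is a normal domain and `S` a domain near the fixed point)
and `dim (T₀)_𝔮̄'` with `dim T_𝔔̄'` (`T` finite FLAT over `T₀`, `…GradedQuotientFree`). Both are
instances of: for an INTEGRAL extension `R → S` satisfying GOING-DOWN and a prime `P` of `S` over `p`,
`ht P = ht p`, hence `dim S_P = dim R_p`. (Mathlib: `Ideal.height_eq_height_add_of_liesOver_of_hasGoingDown`,
Stacks 00ON, plus incomparability `Ideal.IsIntegral.comap_lt_comap` to see that the fibre term vanishes.)

* `height_map_quotient_eq_zero_of_isIntegral` — for `R → S` integral and `P` over `p`, the image of `P`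
  in `S ⧸ pS` is a minimal prime (height `0`);
* **`height_eq_height_of_liesOver_of_isIntegral`** — `R → S` integral with `Algebra.HasGoingDown R S`
  (e.g. flat, or `R` an integrally closed domain and `S` a domain): `P.height = p.height`;
* **`ringKrullDim_atPrime_eq_of_isIntegral`** — hence `dim S_P = dim R_p`.

Honest label: generic commutative-algebra brick (no stub closed). No definitions, no named facts,
no sorry. [cite: Matsumura1987, Thm. 9.4, §13 Thm. 19 (2)] [cite: StacksProject, Tag 00ON]
-/

noncomputable section

-- single-problem summit: the doubled namespace component is forced
set_option linter.dupNamespace false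

namespace Summit.ResolutionOfSingularities.ResolutionOfSingularities.Theorems.FRationalResolution.IntegralHeight

universe u v

variable {R : Type u} {S : Type v} [CommRing R] [CommRing S] [Algebra R S]

/-- **Incomparability ⇒ the fibre has height zero.** For `R → S` integral and a prime `P` of `S`
lying over `p`, the image of `P` in `S ⧸ pS` is a minimal prime: a prime of `S` below `P` and
containing `pS` lies over `p` too, hence equals `P`. [cite: Matsumura1987, Thm. 9.4] -/
theorem height_map_quotient_eq_zero_of_isIntegral [Algebra.IsIntegral R S] (p : Ideal R)
    [p.IsPrime] (P : Ideal S) [P.IsPrime] [P.LiesOver p] :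
    (P.map (Ideal.Quotient.mk (p.map (algebraMap R S)))).height = 0 := by
  have hpP : p.map (algebraMap R S) ≤ P := by
    rw [Ideal.map_le_iff_le_comap, ← Ideal.under_def, ← Ideal.LiesOver.over (p := p) (P := P)]
  haveI hP' : (P.map (Ideal.Quotient.mk (p.map (algebraMap R S)))).IsPrime :=
    Ideal.isPrime_map_quotientMk_of_isPrime hpP
  rw [Ideal.height_eq_zero_iff, minimalPrimes_eq_minimals]
  refine ⟨hP', fun Q hQ hQP => ?_⟩
  -- pull `Q` back to a prime `Q'` of `S` with `pS ≤ Q' ≤ P`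
  set Q' : Ideal S := Q.comap (Ideal.Quotient.mk (p.map (algebraMap R S))) with hQ'
  haveI : Q'.IsPrime := Ideal.IsPrime.comap _
  have hQ'P : Q' ≤ P := by
    intro x hx
    rw [hQ', Ideal.mem_comap] at hx
    have hx' := hQP hx
    rwa [Ideal.mem_quotient_iff_mem hpP] at hx'
  have hpQ' : p.map (algebraMap R S) ≤ Q' := by
    intro x hx
    rw [hQ', Ideal.mem_comap, Ideal.Quotient.eq_zero_iff_mem.mpr hx]
    exact Q.zero_mem
  -- both contract to `p`
  have hunder : Q'.comap (algebraMap R S) = p := by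
    refine le_antisymm ?_ ?_
    · calc Q'.comap (algebraMap R S) ≤ P.comap (algebraMap R S) := Ideal.comap_mono hQ'P
        _ = p := by rw [← Ideal.under_def, ← Ideal.LiesOver.over (p := p) (P := P)]
    · rw [← Ideal.map_le_iff_le_comap]; exact hpQ'
  -- incomparability: `Q' = P`
  have hQ'eq : Q' = P := by
    by_contra hne
    have hlt : Q' < P := lt_of_le_of_ne hQ'P hne
    have h := Ideal.IsIntegral.comap_lt_comap (R := R) hlt
    rw [hunder, ← Ideal.under_def, ← Ideal.LiesOver.over (p := p) (P := P)] at h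
    exact lt_irrefl _ h
  -- hence `P̄ ≤ Q`
  intro x hx
  obtain ⟨y, rfl⟩ := Ideal.Quotient.mk_surjective x
  rw [Ideal.mem_quotient_iff_mem hpP] at hx
  have hy : y ∈ Q' := by rw [hQ'eq]; exact hx
  rw [hQ', Ideal.mem_comap] at hy
  exact hy

/-- **Heights are preserved along integral extensions with going-down**: for `R → S` integral
with `Algebra.HasGoingDown R S` (`R`, `S` Noetherian) and a prime `P` of `S` lying over `p`,
`ht P = ht p`. [cite: Matsumura1987, §13 Thm. 19 (2), Thm. 9.4] [cite: StacksProject, Tag 00ON] -/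
theorem height_eq_height_of_liesOver_of_isIntegral [IsNoetherianRing R] [IsNoetherianRing S]
    [Algebra.IsIntegral R S]
    [Algebra.HasGoingDown R S] (p : Ideal R) [p.IsPrime] (P : Ideal S) [P.IsPrime] [P.LiesOver p] :
    P.height = p.height := by
  rw [Ideal.height_eq_height_add_of_liesOver_of_hasGoingDown p P,
    height_map_quotient_eq_zero_of_isIntegral p P, add_zero]

/-- **Local dimensions agree along integral extensions with going-down**: under the same
hypotheses, `dim S_P = dim R_p`. [cite: Matsumura1987, §13 Thm. 19 (2)] -/
theorem ringKrullDim_atPrime_eq_of_isIntegral [IsNoetherianRing R] [IsNoetherianRing S]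
    [Algebra.IsIntegral R S]
    [Algebra.HasGoingDown R S] (p : Ideal R) [p.IsPrime] (P : Ideal S) [P.IsPrime] [P.LiesOver p] :
    ringKrullDim (Localization.AtPrime P) = ringKrullDim (Localization.AtPrime p) := by
  rw [IsLocalization.AtPrime.ringKrullDim_eq_height P (Localization.AtPrime P),
    IsLocalization.AtPrime.ringKrullDim_eq_height p (Localization.AtPrime p),
    height_eq_height_of_liesOver_of_isIntegral p P]

/-- The FLAT case (e.g. `T` finite free over `T₀`, `…GradedQuotientFree`): `dim S_P = dim R_p`.
[cite: Matsumura1987, §13 Thm. 19 (2)] -/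
theorem ringKrullDim_atPrime_eq_of_flat_of_isIntegral [IsNoetherianRing R] [IsNoetherianRing S]
    [Algebra.IsIntegral R S]
    [Module.Flat R S] (p : Ideal R) [p.IsPrime] (P : Ideal S) [P.IsPrime] [P.LiesOver p] :
    ringKrullDim (Localization.AtPrime P) = ringKrullDim (Localization.AtPrime p) :=
  ringKrullDim_atPrime_eq_of_isIntegral p P

/-- The NORMAL-DOMAIN case (e.g. `S₀ ⊆ S` near a fixed point: `S₀` integrally closed domain, `S` a
domain, integral): `dim S_P = dim R_p`. [cite: Matsumura1987, Thm. 9.4 (going down)] -/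
theorem ringKrullDim_atPrime_eq_of_isIntegrallyClosed_of_isIntegral [IsNoetherianRing R]
    [IsNoetherianRing S] [IsDomain S]
    [FaithfulSMul R S] [Algebra.IsIntegral R S] [IsIntegrallyClosed R] (p : Ideal R) [p.IsPrime]
    (P : Ideal S) [P.IsPrime] [P.LiesOver p] :
    ringKrullDim (Localization.AtPrime P) = ringKrullDim (Localization.AtPrime p) :=
  ringKrullDim_atPrime_eq_of_isIntegral p P

end Summit.ResolutionOfSingularities.ResolutionOfSingularities.Theorems.FRationalResolution.IntegralHeight

end
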